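import Summits.QuantumFields.YangMills.Theorems.F4SubCurvatureDoorJointAnalyticityOffMirrorsMain
import Literature.MathematicalPhysics.QuantumFieldTheory.MirrorRPKernel
import Mathlib
import HarnessLib

/-!
# Route `F4SubCurvatureDoor`, crux ⟨stmt-QuantumFields-23125⟩ `RationalToGeneral` / parent ⟨23035⟩ `ShortRootRigidity`:
# LINE g16-A «GLOBAL REDUCTION» — SHORT-ROOT reflection positivity, OS continuation and axis analyticity under GLOBAL symmetry

Port (def-free, on top of the tree theorems of `F4SubCurvatureDoorMirrorContinuation` / `…JointAnalyticityOffMirrorsMain`) of the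
route owner's support files `HOME ym-idea-3/l16/ShortRootRP.lean` and `l16/AxisAnalyticity.lean` (planner `ym-idea-3` g16, evidence
#15/#16 on ⟨23125⟩; critic idea-crit-4 RECORD 2026-08-29T00:29Z/00:30Z).  For a kernel `K : ℝ⁴ → ℝ` of the ⟨23035⟩ class
(continuous off `0`, bounded outside the unit ball, `W(B₄)`-invariant (`IsSignedPerm`), reflection positive across `x₀ = 0`):

* `isMirrorRPKernel_of_invariant` — if moreover `K ∘ R = K` for a linear isometry `R`, then `K` is mirror-RP across `(R e₀)ᗮ`
  (tree lemma `IsMirrorRPKernel.map_normal_iff_of_invariant` on `isMirrorRPKernel_single`);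
* `continuation_of_invariant` — and every slice `t ↦ K (t • R e₀ + y)`, `y ⊥ R e₀`, `t > 0`, is the trace of a function holomorphic
  on `{Re t > 0}` dominated by `K ((Re t) • R e₀)` (tree theorem `IsMirrorRPKernel.exists_halfPlane_continuation`);
* `exists_hadamard_frame` — the Hadamard frame `H₄ = ½[[1,1,1,1],[1,1,-1,-1],[1,-1,1,-1],[1,-1,-1,1]]` is a linear isometry of `ℝ⁴`
  mapping the checkerboard lattice `D₄ = {z ∈ ℤ⁴ : Σ zᵢ even}` into itself, with `H₄ e₀ = ½(1,1,1,1)` and `H₄ (a eₖ)` having all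
  four coordinates `± a/2` (stated as an existence theorem — no definition is introduced);
* hence, under the GLOBAL `D₄`-lattice invariance of the global form C3 of ⟨23035⟩: `isMirrorRPKernel_diag` / `diag_continuation`
  (RP and OS continuation across the diagonal short-root mirror `{Σ xᵢ = 0}`, normal `½(1,1,1,1)`), `isMirrorRPKernel_signedPerm_diag`
  (all eight diagonal short-root mirrors; with `isMirrorRPKernel_single` this is RP across ALL TWELVE short-root mirrors of `F₄`,
  `W(B₄)·{e₀, H₄e₀}` — the position-space, general-`K` form of the «short-root Wick hyperbolicity» of Theorem A, ⟨23124⟩), and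
  `analyticAt_axis` / `analyticAt_axis_of_class` (with C1 `jointAnalyticityOffMirrors`: such `K` are real-analytic at every non-zero
  point of every coordinate AXIS, i.e. off a codimension-2 cone only).

The long-root mirrors `xᵢ = ± xⱼ` are deliberately absent (no lattice isometry maps `e₀` to a long root; negatives ⟨9665⟩).
Mathlib + tree only; THEOREMS ONLY; no `sorry`; standard axioms.  HONEST FRAMING: support lemmas toward the OPEN wall C3
(`--supports stmt-QuantumFields-23125`); nothing here proves a crux, the leaf ⟨23125⟩, a rung of LADDER-YM (`BalabanLadder.ROT`) or any
mass-gap statement.  Seat `ym-line-frs-p2` g12 (free hands), porting the owner's files. [folklore]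
-/

set_option autoImplicit false

noncomputable section

namespace Summit.QuantumFields.YangMills.Theorems.F4SubCurvatureDoorGlobalReduction

open scoped Topology InnerProductSpace BigOperators
open Filter Set Metric
open Literature.MathematicalPhysics.QuantumLattice (timeReflection timeReflection_apply siteToE siteToE_apply)
open Literature.MathematicalPhysics.QuantumFieldTheory (IsMirrorRPKernel isMirrorRPKernel_neg_arg_iff mirrorReflection_map_apply)
open Summit.QuantumFields.YangMills.Cruxes.OSLegsAtWeakCouplingC.Sketch (IsSignedPerm)

/-! ## §1 RP and OS continuation across the mirror of `R e₀` for a global symmetry `R` of `K` -/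

section Invariant

variable {K : EuclideanSpace ℝ (Fin 4) → ℝ}

/-- **Transport of reflection positivity by a global symmetry.**  If `K` is `W(B₄)`-invariant and reflection positive across
`x₀ = 0`, and `K ∘ R = K` for a linear isometry `R` of `ℝ⁴`, then `K` is mirror-RP across the hyperplane `(R e₀)ᗮ`.
[cite: GlimmJaffeQP1987, Def. 6.2.1] -/
theorem isMirrorRPKernel_of_invariant
    (hB : ∀ R : EuclideanSpace ℝ (Fin 4) ≃ₗᵢ[ℝ] EuclideanSpace ℝ (Fin 4), IsSignedPerm R → ∀ x, K (R x) = K x)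
    (hRP : ∀ (m : ℕ) (x : Fin m → EuclideanSpace ℝ (Fin 4)) (c : Fin m → ℝ), (∀ i, 0 < x i 0) →
        0 ≤ ∑ i, ∑ j, c i * c j * K (timeReflection 4 (x i) - x j))
    (R : EuclideanSpace ℝ (Fin 4) ≃ₗᵢ[ℝ] EuclideanSpace ℝ (Fin 4)) (hinv : ∀ x, K (R x) = K x) :
    IsMirrorRPKernel (R (EuclideanSpace.single 0 (1 : ℝ))) K :=
  (IsMirrorRPKernel.map_normal_iff_of_invariant R hinv).mpr (isMirrorRPKernel_single hB hRP 0)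

/-- **OS / Bernstein–Widder continuation of the slices normal to the mirror `(R e₀)ᗮ`**, for a global symmetry `R` of a kernel of
the ⟨23035⟩ class: for `y ⊥ R e₀`, `t ↦ K (t • R e₀ + y)` (`t > 0`) is the trace of a function holomorphic on `{Re t > 0}` with
`‖F t‖ ≤ K ((Re t) • R e₀)`. [cite: GlimmJaffeQP1987, §6.1 Thm. 6.1.3] -/
theorem continuation_of_invariant (hK : ContinuousOn K {x | x ≠ 0}) (hbd : ∃ C : ℝ, ∀ x, 1 ≤ ‖x‖ → |K x| ≤ C)
    (hB : ∀ R : EuclideanSpace ℝ (Fin 4) ≃ₗᵢ[ℝ] EuclideanSpace ℝ (Fin 4), IsSignedPerm R → ∀ x, K (R x) = K x)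
    (hRP : ∀ (m : ℕ) (x : Fin m → EuclideanSpace ℝ (Fin 4)) (c : Fin m → ℝ), (∀ i, 0 < x i 0) →
        0 ≤ ∑ i, ∑ j, c i * c j * K (timeReflection 4 (x i) - x j))
    (R : EuclideanSpace ℝ (Fin 4) ≃ₗᵢ[ℝ] EuclideanSpace ℝ (Fin 4)) (hinv : ∀ x, K (R x) = K x)
    {y : EuclideanSpace ℝ (Fin 4)} (hy : ⟪y, R (EuclideanSpace.single 0 (1 : ℝ))⟫_ℝ = 0) :
    ∃ F : ℂ → ℂ, DifferentiableOn ℂ F {t : ℂ | 0 < t.re} ∧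
      (∀ t : ℝ, 0 < t → F t = ((K (t • R (EuclideanSpace.single 0 (1 : ℝ)) + y) : ℝ) : ℂ)) ∧
      (∀ t : ℂ, 0 < t.re → ‖F t‖ ≤ K (t.re • R (EuclideanSpace.single 0 (1 : ℝ)))) := by
  have heven : ∀ x, K (-x) = K x := even_of_signedPerm hB
  have hK' : ContinuousOn K ({0}ᶜ : Set (EuclideanSpace ℝ (Fin 4))) := by
    have : ({0}ᶜ : Set (EuclideanSpace ℝ (Fin 4))) = {x | x ≠ 0} := by ext x; simp
    rw [this]; exact hK
  set e : EuclideanSpace ℝ (Fin 4) := EuclideanSpace.single 0 (1 : ℝ) with he_def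
  set n : EuclideanSpace ℝ (Fin 4) := R e with hn_def
  have hnorm_e : ‖e‖ = 1 := norm_single_one 0
  have hnorm_n : ‖n‖ = 1 := by rw [hn_def, LinearIsometryEquiv.norm_map, hnorm_e]
  have hn : n ≠ 0 := by
    intro h; have := hnorm_n; rw [h, norm_zero] at this; exact zero_ne_one this
  have hunit : ‖n‖⁻¹ • n = n := by rw [hnorm_n, inv_one, one_smul]
  have hunit_e : ‖e‖⁻¹ • e = e := by rw [hnorm_e, inv_one, one_smul]
  have hinner_n : ∀ x : EuclideanSpace ℝ (Fin 4), ⟪x, n⟫_ℝ = ⟪R.symm x, e⟫_ℝ := fun x => by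
    conv_lhs => rw [← R.apply_symm_apply x]
    rw [hn_def, LinearIsometryEquiv.inner_map_map]
  -- half-space bounds transported through `R`
  have hslab : ∀ t₀ : ℝ, 0 < t₀ → ∃ M' : ℝ, ∀ x : EuclideanSpace ℝ (Fin 4),
      t₀ ≤ ⟪x, ‖n‖⁻¹ • n⟫_ℝ → |K x| ≤ M' := by
    intro t₀ ht₀
    obtain ⟨M', hM'⟩ := slab_bound hK hbd 0 t₀ ht₀
    refine ⟨M', fun x hx => ?_⟩
    rw [hunit, hinner_n] at hx
    have := hM' (R.symm x) (by rwa [hunit_e])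
    rwa [← hinv (R.symm x), R.apply_symm_apply] at this
  -- mirror invariance transported through `R`
  have hinvrefl : ∀ x, K ((ℝ ∙ n)ᗮ.reflection x) = K x := fun x => by
    conv_lhs => rw [← R.apply_symm_apply x]
    rw [hn_def, mirrorReflection_map_apply, hinv, mirror_invariant_of_signedPerm hB 0, ← hinv (R.symm x),
      R.apply_symm_apply]
  have hRPn : IsMirrorRPKernel n K := isMirrorRPKernel_of_invariant hB hRP R hinv
  obtain ⟨F, hFd, hFr, hFb⟩ :=
    IsMirrorRPKernel.exists_halfPlane_continuation hn hK' heven hslab hinvrefl hRPn hy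
  refine ⟨F, hFd, fun t ht => ?_, fun t ht => ?_⟩
  · rw [hFr t ht, hunit]
  · have := hFb t ht; rwa [hunit] at this

end Invariant

/-! ## §2 The Hadamard frame `H₄ ∈ Aut(D₄)` (existence; no definition introduced) -/

/-- **The Hadamard frame.**  There is a linear isometry `H` of `ℝ⁴` — the symmetric orthogonal matrix
`H₄ = ½[[1,1,1,1],[1,1,-1,-1],[1,-1,1,-1],[1,-1,-1,1]]` — with the coordinate formulas below; it maps the checkerboard lattice
`D₄ = {z ∈ ℤ⁴ : Σ zᵢ even}` into itself (so it is one of the lattice isometries of ⟨23035⟩ / C3), sends `e₀` to the diagonal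
short root `½(1,1,1,1)`, and sends every axis vector `a eₖ` to a vector all of whose coordinates are `± a/2`. [folklore] -/
theorem exists_hadamard_frame :
    ∃ H : EuclideanSpace ℝ (Fin 4) ≃ₗᵢ[ℝ] EuclideanSpace ℝ (Fin 4),
      (∀ x : EuclideanSpace ℝ (Fin 4),
        H x 0 = (x 0 + x 1 + x 2 + x 3) / 2 ∧ H x 1 = (x 0 + x 1 - x 2 - x 3) / 2 ∧
        H x 2 = (x 0 - x 1 + x 2 - x 3) / 2 ∧ H x 3 = (x 0 - x 1 - x 2 + x 3) / 2) ∧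
      (∀ z : Fin 4 → ℤ, Even (∑ i, z i) → ∃ w : Fin 4 → ℤ, Even (∑ i, w i) ∧ H (siteToE z) = siteToE w) ∧
      (∀ j : Fin 4, H (EuclideanSpace.single 0 (1 : ℝ)) j = 1 / 2) ∧
      (∀ (k j : Fin 4) (a : ℝ),
        H (EuclideanSpace.single k a) j = a / 2 ∨ H (EuclideanSpace.single k a) j = -(a / 2)) := by
  -- the coordinate map
  let f : EuclideanSpace ℝ (Fin 4) → (Fin 4 → ℝ) := fun x =>
    ![(x 0 + x 1 + x 2 + x 3) / 2, (x 0 + x 1 - x 2 - x 3) / 2, (x 0 - x 1 + x 2 - x 3) / 2, (x 0 - x 1 - x 2 + x 3) / 2]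
  let L : EuclideanSpace ℝ (Fin 4) →ₗ[ℝ] EuclideanSpace ℝ (Fin 4) :=
    { toFun := fun x => WithLp.toLp 2 (f x)
      map_add' := fun x y => by
        ext j
        fin_cases j <;> simp [f] <;> ring
      map_smul' := fun c x => by
        ext j
        fin_cases j <;> simp [f] <;> ring }
  have hL : ∀ (x : EuclideanSpace ℝ (Fin 4)) (j : Fin 4), L x j = f x j := fun x j => rfl
  have hLL : ∀ x, L (L x) = x := fun x => by
    ext j
    fin_cases j <;> simp [hL, f] <;> ring
  let Le : EuclideanSpace ℝ (Fin 4) ≃ₗ[ℝ] EuclideanSpace ℝ (Fin 4) :=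
    { L with
      invFun := L
      left_inv := hLL
      right_inv := hLL }
  have hnorm : ∀ x : EuclideanSpace ℝ (Fin 4), ‖Le x‖ = ‖x‖ := fun x => by
    show ‖L x‖ = ‖x‖
    rw [EuclideanSpace.norm_eq, EuclideanSpace.norm_eq]
    congr 1
    simp only [Fin.sum_univ_four, Real.norm_eq_abs, sq_abs, hL, f]
    simp
    ring
  let H : EuclideanSpace ℝ (Fin 4) ≃ₗᵢ[ℝ] EuclideanSpace ℝ (Fin 4) := LinearIsometryEquiv.mk Le hnorm
  have hH : ∀ (x : EuclideanSpace ℝ (Fin 4)) (j : Fin 4), H x j = f x j := fun x j => rfl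
  refine ⟨H, fun x => ⟨rfl, rfl, rfl, rfl⟩, ?_, ?_, ?_⟩
  · -- `H₄` preserves `D₄`
    intro z hz
    obtain ⟨m, hm⟩ := hz
    rw [Fin.sum_univ_four] at hm
    have hm' : (z 0 : ℝ) + z 1 + z 2 + z 3 = m + m := by exact_mod_cast hm
    refine ⟨![m, m - z 2 - z 3, m - z 1 - z 3, m - z 1 - z 2], ⟨2 * m - z 1 - z 2 - z 3, ?_⟩, ?_⟩
    · simp [Fin.sum_univ_four]
      ring
    · ext j
      fin_cases j <;> simp [hH, f, siteToE_apply] <;> linarith [hm']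
  · -- `H₄ e₀ = ½(1,1,1,1)`
    intro j
    fin_cases j <;> simp [hH, f]
  · -- `H₄ (a eₖ)` has coordinates `± a/2`
    intro k j a
    fin_cases k <;> fin_cases j <;> simp [hH, f] <;> ring_nf <;> simp

/-! ## §3 Consequences under GLOBAL `D₄`-lattice invariance: the diagonal short root and the coordinate axes -/

section Global

variable {K : EuclideanSpace ℝ (Fin 4) → ℝ}

/-- **Analyticity through a global symmetry**: if `K ∘ H = K` for a linear isometry `H` and `K` is analytic on the open
orthants, then `K` is analytic at every `x` whose image `H x` lies in an open orthant. [folklore] -/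
theorem analyticAt_of_frame (hA : AnalyticOnNhd ℝ K {x | ∀ i, x i ≠ 0})
    (H : EuclideanSpace ℝ (Fin 4) ≃ₗᵢ[ℝ] EuclideanSpace ℝ (Fin 4)) (hinv : ∀ x, K (H x) = K x)
    (x : EuclideanSpace ℝ (Fin 4)) (hx : ∀ i, H x i ≠ 0) : AnalyticAt ℝ K x := by
  have hlin : AnalyticAt ℝ (fun y => H y) x :=
    (H.toContinuousLinearEquiv : EuclideanSpace ℝ (Fin 4) →L[ℝ] EuclideanSpace ℝ (Fin 4)).analyticAt x
  have hcomp : AnalyticAt ℝ (fun y => K (H y)) x := (hA (H x) hx).comp hlin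
  have hfun : (fun y => K (H y)) = K := funext hinv
  rwa [hfun] at hcomp

/-- **Analyticity on the axes.**  If `K` is analytic on the open orthants `{∀ i, xᵢ ≠ 0}` and invariant under every linear
isometry preserving the checkerboard lattice `D₄` (the GLOBAL lattice invariance of C3), then `K` is real-analytic at every
non-zero point `a eₖ` of every coordinate axis: the Hadamard frame maps `a eₖ` off all four coordinate mirrors. [folklore] -/
theorem analyticAt_axis (hA : AnalyticOnNhd ℝ K {x | ∀ i, x i ≠ 0})
    (hlat : ∀ R : EuclideanSpace ℝ (Fin 4) ≃ₗᵢ[ℝ] EuclideanSpace ℝ (Fin 4),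
      (∀ z : Fin 4 → ℤ, Even (∑ i, z i) → ∃ w : Fin 4 → ℤ, Even (∑ i, w i) ∧ R (siteToE z) = siteToE w) →
      ∀ x, K (R x) = K x)
    (k : Fin 4) {a : ℝ} (ha : a ≠ 0) : AnalyticAt ℝ K (EuclideanSpace.single k a) := by
  obtain ⟨H, _, hHlat, _, hHax⟩ := exists_hadamard_frame
  refine analyticAt_of_frame hA H (hlat H hHlat) _ fun j => ?_
  rcases hHax k j a with h | h <;> rw [h]
  · exact div_ne_zero ha two_ne_zero
  · exact neg_ne_zero.mpr (div_ne_zero ha two_ne_zero)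

/-- **Axis analyticity for the global class C3** (C1 `jointAnalyticityOffMirrors` + `analyticAt_axis`): a kernel of the ⟨23035⟩
class which is invariant under every `D₄`-lattice isometry is real-analytic at every non-zero axis point — so it is analytic off
the codimension-2 cone `{∃ i, xᵢ = 0} ∩ {∃ i, (H₄ x)ᵢ = 0}`. [folklore] -/
theorem analyticAt_axis_of_class (hK : ContinuousOn K {x | x ≠ 0}) (hbd : ∃ C : ℝ, ∀ x, 1 ≤ ‖x‖ → |K x| ≤ C)
    (hB : ∀ R : EuclideanSpace ℝ (Fin 4) ≃ₗᵢ[ℝ] EuclideanSpace ℝ (Fin 4), IsSignedPerm R → ∀ x, K (R x) = K x)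
    (hRP : ∀ (m : ℕ) (x : Fin m → EuclideanSpace ℝ (Fin 4)) (c : Fin m → ℝ), (∀ i, 0 < x i 0) →
        0 ≤ ∑ i, ∑ j, c i * c j * K (timeReflection 4 (x i) - x j))
    (hlat : ∀ R : EuclideanSpace ℝ (Fin 4) ≃ₗᵢ[ℝ] EuclideanSpace ℝ (Fin 4),
      (∀ z : Fin 4 → ℤ, Even (∑ i, z i) → ∃ w : Fin 4 → ℤ, Even (∑ i, w i) ∧ R (siteToE z) = siteToE w) →
      ∀ x, K (R x) = K x)
    (k : Fin 4) {a : ℝ} (ha : a ≠ 0) : AnalyticAt ℝ K (EuclideanSpace.single k a) :=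
  analyticAt_axis (jointAnalyticityOffMirrors K hK hbd hB hRP) hlat k ha

/-- The diagonal short root `½(1,1,1,1)` is the image of `e₀` under the Hadamard frame. [folklore] -/
theorem exists_frame_map_single_eq_diag :
    ∃ H : EuclideanSpace ℝ (Fin 4) ≃ₗᵢ[ℝ] EuclideanSpace ℝ (Fin 4),
      (∀ z : Fin 4 → ℤ, Even (∑ i, z i) → ∃ w : Fin 4 → ℤ, Even (∑ i, w i) ∧ H (siteToE z) = siteToE w) ∧
      H (EuclideanSpace.single 0 (1 : ℝ)) = WithLp.toLp 2 (fun _ : Fin 4 => (1 / 2 : ℝ)) := by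
  obtain ⟨H, _, hHlat, hHe, _⟩ := exists_hadamard_frame
  refine ⟨H, hHlat, ?_⟩
  ext j
  rw [hHe j]

/-- **RP across the diagonal short-root mirror.**  Under `W(B₄)`-invariance, reflection positivity across `x₀ = 0` and GLOBAL
`D₄`-lattice invariance, `K` is mirror-RP across `{Σ xᵢ = 0}` (normal `½(1,1,1,1) = H₄ e₀`). [cite: GlimmJaffeQP1987, Def. 6.2.1] -/
theorem isMirrorRPKernel_diag
    (hB : ∀ R : EuclideanSpace ℝ (Fin 4) ≃ₗᵢ[ℝ] EuclideanSpace ℝ (Fin 4), IsSignedPerm R → ∀ x, K (R x) = K x)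
    (hRP : ∀ (m : ℕ) (x : Fin m → EuclideanSpace ℝ (Fin 4)) (c : Fin m → ℝ), (∀ i, 0 < x i 0) →
        0 ≤ ∑ i, ∑ j, c i * c j * K (timeReflection 4 (x i) - x j))
    (hlat : ∀ R : EuclideanSpace ℝ (Fin 4) ≃ₗᵢ[ℝ] EuclideanSpace ℝ (Fin 4),
      (∀ z : Fin 4 → ℤ, Even (∑ i, z i) → ∃ w : Fin 4 → ℤ, Even (∑ i, w i) ∧ R (siteToE z) = siteToE w) →
      ∀ x, K (R x) = K x) :
    IsMirrorRPKernel (WithLp.toLp 2 (fun _ : Fin 4 => (1 / 2 : ℝ)) : EuclideanSpace ℝ (Fin 4)) K := by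
  obtain ⟨H, hHlat, hHe⟩ := exists_frame_map_single_eq_diag
  rw [← hHe]
  exact isMirrorRPKernel_of_invariant hB hRP H (hlat H hHlat)

/-- **RP across all eight diagonal short-root mirrors** (normals `(±½,±½,±½,±½) = R(½(1,1,1,1))`, `R ∈ W(B₄)`); together with
`isMirrorRPKernel_single` (the four coordinate mirrors) this is reflection positivity across all twelve short-root mirrors of `F₄`.
[cite: GlimmJaffeQP1987, Def. 6.2.1] -/
theorem isMirrorRPKernel_signedPerm_diag
    (hB : ∀ R : EuclideanSpace ℝ (Fin 4) ≃ₗᵢ[ℝ] EuclideanSpace ℝ (Fin 4), IsSignedPerm R → ∀ x, K (R x) = K x)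
    (hRP : ∀ (m : ℕ) (x : Fin m → EuclideanSpace ℝ (Fin 4)) (c : Fin m → ℝ), (∀ i, 0 < x i 0) →
        0 ≤ ∑ i, ∑ j, c i * c j * K (timeReflection 4 (x i) - x j))
    (hlat : ∀ R : EuclideanSpace ℝ (Fin 4) ≃ₗᵢ[ℝ] EuclideanSpace ℝ (Fin 4),
      (∀ z : Fin 4 → ℤ, Even (∑ i, z i) → ∃ w : Fin 4 → ℤ, Even (∑ i, w i) ∧ R (siteToE z) = siteToE w) →
      ∀ x, K (R x) = K x)
    (R : EuclideanSpace ℝ (Fin 4) ≃ₗᵢ[ℝ] EuclideanSpace ℝ (Fin 4)) (hR : IsSignedPerm R) :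
    IsMirrorRPKernel (R (WithLp.toLp 2 (fun _ : Fin 4 => (1 / 2 : ℝ)) : EuclideanSpace ℝ (Fin 4))) K :=
  (IsMirrorRPKernel.map_normal_iff_of_invariant R (hB R hR)).mpr (isMirrorRPKernel_diag hB hRP hlat)

/-- **OS continuation across the diagonal short-root mirror.**  For `K` of the ⟨23035⟩ class with GLOBAL `D₄`-lattice invariance
and `y ⊥ ½(1,1,1,1)`, the slice `t ↦ K (t • ½(1,1,1,1) + y)` (`t > 0`) is the trace of a function holomorphic on `{Re t > 0}`
dominated by its on-axis values. [cite: GlimmJaffeQP1987, §6.1 Thm. 6.1.3] -/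
theorem diag_continuation (hK : ContinuousOn K {x | x ≠ 0}) (hbd : ∃ C : ℝ, ∀ x, 1 ≤ ‖x‖ → |K x| ≤ C)
    (hB : ∀ R : EuclideanSpace ℝ (Fin 4) ≃ₗᵢ[ℝ] EuclideanSpace ℝ (Fin 4), IsSignedPerm R → ∀ x, K (R x) = K x)
    (hRP : ∀ (m : ℕ) (x : Fin m → EuclideanSpace ℝ (Fin 4)) (c : Fin m → ℝ), (∀ i, 0 < x i 0) →
        0 ≤ ∑ i, ∑ j, c i * c j * K (timeReflection 4 (x i) - x j))
    (hlat : ∀ R : EuclideanSpace ℝ (Fin 4) ≃ₗᵢ[ℝ] EuclideanSpace ℝ (Fin 4),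
      (∀ z : Fin 4 → ℤ, Even (∑ i, z i) → ∃ w : Fin 4 → ℤ, Even (∑ i, w i) ∧ R (siteToE z) = siteToE w) →
      ∀ x, K (R x) = K x)
    {y : EuclideanSpace ℝ (Fin 4)} (hy : ⟪y, (WithLp.toLp 2 (fun _ : Fin 4 => (1 / 2 : ℝ)) : EuclideanSpace ℝ (Fin 4))⟫_ℝ = 0) :
    ∃ F : ℂ → ℂ, DifferentiableOn ℂ F {t : ℂ | 0 < t.re} ∧
      (∀ t : ℝ, 0 < t → F t = ((K (t • (WithLp.toLp 2 (fun _ : Fin 4 => (1 / 2 : ℝ)) : EuclideanSpace ℝ (Fin 4)) + y) : ℝ) : ℂ)) ∧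
      (∀ t : ℂ, 0 < t.re → ‖F t‖ ≤ K (t.re • (WithLp.toLp 2 (fun _ : Fin 4 => (1 / 2 : ℝ)) : EuclideanSpace ℝ (Fin 4)))) := by
  obtain ⟨H, hHlat, hHe⟩ := exists_frame_map_single_eq_diag
  rw [← hHe] at hy ⊢
  exact continuation_of_invariant hK hbd hB hRP H (hlat H hHlat) hy

end Global

end Summit.QuantumFields.YangMills.Theorems.F4SubCurvatureDoorGlobalReduction

end
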